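import Summits.QuantumAdvantage.AdviceFreeQNC0.AffBells26FlipCubeSieve
import HarnessLib

/-!
# The LIGHT WITNESS: the universal cube-refutability conjecture `CubeRefutableAll` is false (qn-p1 g27, ROUND-26 §2)

A row `g` survives a creation cube `(x, A)` with `|A| ≥ 2` only if it SEES every other centre (`d β x g a ≠ 0`), which needs
`β g (a-1) ≠ 0` or `β g (a+1) ≠ 0`.  For the zero matrix `β = 0` (the CONSTANT strategies `z_g = [0 = c_g]`) no row sees anything:
`Surv 0 x A = ∅`, `survSum 0 c x A = 0`, so no cube has odd survivors' sum and `CubeRefutable 0` fails for every `N`.  Hence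
`CubeRefutableAll` (ROUND-25 "Theorem S26", typed in `AffBells26FlipCubeSieve`) is FALSE as stated, and the packaging
`noPerfectAffineBells3_of_S26` has an unsatisfiable hypothesis.  The same witness kills every universally quantified ("∀ β") cube /
move-cube / local-certificate refutability statement (ROUND-26 §2: `CubeRefutableGenAll`, `S26LocalBounded`, `S26LocalLog`); the
correctly guarded form is `CubeRefutableDense` (no zero entry), and in general the sieve needs a HEAVINESS hypothesis on `β` while
LIGHT strategies (rows of weight ≤ 1, more generally rows that cannot see two disjoint moves) need a separate argument (R0 for
weight 0).  Constant strategies are of course not perfect (`RingFixedBellsSharp3`); the point is only that cubes cannot show it.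
-/



namespace Summit.QuantumAdvantage.AdviceFreeQNC0

namespace AffBells26

open Finset Literature.Computability.QuantumComplexity Literature.Computability.QuantumComplexity.RingHLF
open AffBells23 Fib19

/-- For the zero matrix every drift vanishes. -/
theorem d_zero {N : ℕ} (x : Fin N → Bool) (g a : Fin N) : d (0 : Fin N → Fin N → ZMod 3) x g a = 0 := by
  simp [d]

/-- For the zero matrix no row survives a cube with at least two centres. -/
theorem surv_zero {N : ℕ} (x : Fin N → Bool) (A : Finset (Fin N)) (hA : 2 ≤ A.card) :
    Surv (0 : Fin N → Fin N → ZMod 3) x A = ∅ := by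
  unfold Surv
  refine Finset.filter_eq_empty_iff.mpr ?_
  intro g _ hg
  have hcard : 1 ≤ (A.erase g).card := by
    have := Finset.card_erase_add_one (s := A) (a := g)
    by_cases hg' : g ∈ A
    · have h1 := Finset.card_erase_add_one hg'
      omega
    · rw [Finset.erase_eq_of_notMem hg']
      omega
  obtain ⟨a, ha⟩ := Finset.card_pos.mp (by omega : 0 < (A.erase g).card)
  exact hg.2 a ha (d_zero x g a)

/-- Hence the survivors' sum of the zero matrix vanishes. -/
theorem survSum_zero {N : ℕ} (c : Fin N → ZMod 3) (x : Fin N → Bool) (A : Finset (Fin N)) (hA : 2 ≤ A.card) :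
    survSum (0 : Fin N → Fin N → ZMod 3) c x A = 0 := by
  unfold survSum
  rw [surv_zero x A hA]
  simp

/-- The zero matrix is not cube-refutable (at any `N`). -/
theorem not_cubeRefutable_zero (N : ℕ) : ¬ CubeRefutable (0 : Fin N → Fin N → ZMod 3) := by
  intro h
  obtain ⟨x, A, _, _, hcard, hodd⟩ := h 0
  rw [survSum_zero 0 x A hcard] at hodd
  omega

/-- **`CubeRefutableAll` is false** (witness `β = 0` at `N = N₀`). -/
theorem not_cubeRefutableAll : ¬ CubeRefutableAll := by
  rintro ⟨N₀, h⟩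
  exact not_cubeRefutable_zero N₀ (h N₀ le_rfl 0)

end AffBells26

end Summit.QuantumAdvantage.AdviceFreeQNC0
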